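import Summits.AtomisticToContinuum.Crystallization.Theorems.ThreeConeCertificateSlackRigidityPricedFloorsIdent
import Summits.AtomisticToContinuum.Crystallization.Theorems.ThreeConeCertificateSlackRigidityPricedFloorsTransport2
import HarnessLib

/-!
# `SlackRigidity` (stmt-AtomisticToContinuum-11960), line `priced-floors-palm-exactification`, stub S3
# (`stub_layeredMeanSelection`), package (II): increment functionals, part 1 — transport identifications

Lead c19, worker package (II) for the mean increment argument `lms_increments_ae_zero'`
(`…PricedFloorsIncrements`), deterministic part.  For data `e = (T, a, s, z)` fitting a sample `S`
write (all functionals are kept INLINE in the statements, no definitions are introduced)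

* `LE e m := Φ₀(a) + Σ'_{m' ≠ m} Φ(z m' − z m, L m' − L m)` — the actual energy of layer `m`
  (`= 2h` of the sample re-rooted at a point of layer `m`, `LayerEnergy.two_mul_rootEnergy_reroot`);
* `jump e i := ((z(i+1) − z i) − (z(i+2) − z(i+1)))²` — the squared increment jump;
* `AE n e := (1/(2n+1)) Σ_{|m| ≤ n} LE e m`, `BE n e := Σ_{|m| ≤ n+1} c' m · LE e m` with the
  symmetrised shifted weights `c' m = (1[m ∈ [−n+1, n+1]] + 1[m ∈ [−n−1, n−1]]) / (2(2n+1))`;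
* `DE e := jump e 0 + jump e (−2)`, `DtE n e := (1/(2n+1)) Σ_{|m| ≤ n} (jump e m + jump e (m−2))`.

This file proves:

* `lms_lintegral_weighted_eq` (registered) — the transported integral of a layerwise constant
  nonnegative function against FINITELY SUPPORTED NONNEGATIVE LAYER WEIGHTS
  `w(y) = Σ_{|m| ≤ N} c m · 1[y ∈ T m]/#(T m)` over counting measure is `Σ c m · (value on T m)`
  (generalises `Ident.lms_lintegral_avg_eq`, uniform weights);
* `lms_ident_A`, `lms_ident_B`, `lms_ident_D` (registered) — the three identifications of
  `lms_increments_ae_zero'` in deterministic form: against the uniform layer weights over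
  `|m| ≤ n` a function with value `LE e m + K` (resp. `jump e m + jump e (m−2) + K`) on layer `m`
  integrates to `AE n e + K` (resp. `DtE n e + K`), and against the weights `c'` to `BE n e + K`;
* `DE_rerootData` (registered) — `DE (rerootData e m) = jump e m + jump e (m − 2)`;
* `shiftCoeff_props` (registered) — `c' ≥ 0`, `c'(−m) = c' m`, `c' m = 0` for `|m| > n+1`,
  `Σ c' = 1` (the hypotheses of the kernel package for the weights `c'`).

All `[folklore]` bookkeeping.
-/

noncomputable section

open MeasureTheory Filter Set
open scoped ENNReal BigOperators Topology

namespace Summit.AtomisticToContinuum.Crystallization.Theorems.SlackRigidityPricedFloorsIncrIdent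

open Literature.MathematicalPhysics.StatisticalMechanics
open Summit.AtomisticToContinuum.Crystallization.Theorems.SlackRigidityPricedFloors
open Summit.AtomisticToContinuum.Crystallization.Theorems.SlackRigidityPricedFloorsTransport

/-! ## Weighted transported integrals over counting measure -/

/-- **The transported integral of a layerwise constant function, general layer weights** (registered
sub-goal `lms_lintegral_weighted_eq`): for a countable `S`, nonempty pairwise disjoint finite
`T m ⊆ S`, nonnegative coefficients `c`, the weight `w(y) = Σ_{|m| ≤ N} c m · 1[y ∈ T m]/#(T m)` and
a nonnegative `g` constant `= cval m` on each `T m`,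
`∫⁻ ofReal(w) ofReal(g) d(count|S) = ofReal(Σ_{|m| ≤ N} c m · cval m)`. [folklore] -/
theorem lms_lintegral_weighted_eq : ∀ (S : Set E3), S.Countable → ∀ (T : ℤ → Finset E3), (∀ m, (↑(T m) : Set E3) ⊆ S) → (∀ m, (T m).Nonempty) → (∀ m m', m ≠ m' → Disjoint (T m) (T m')) → ∀ (N : ℕ) (c : ℤ → ℝ), (∀ m, 0 ≤ c m) → ∀ (w g : E3 → ℝ) (cval : ℤ → ℝ), (∀ y, w y = ∑ m ∈ Finset.Icc (-(N : ℤ)) N, c m * (if y ∈ T m then (1 : ℝ) / (T m).card else 0)) → (∀ y, 0 ≤ g y) → (∀ m, ∀ y ∈ T m, g y = cval m) → ∫⁻ y, ENNReal.ofReal (w y) * ENNReal.ofReal (g y) ∂((Measure.count : Measure E3).restrict S) = ENNReal.ofReal (∑ m ∈ Finset.Icc (-(N : ℤ)) N, c m * cval m) := by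
  intro S hS T hTS hTne hTd N c hc w g cval hw hg hgc
  -- adapted from SlackRigidityPricedFloorsIdent.lms_lintegral_avg_eq (uniform weights)
  set F : Finset E3 := (Finset.Icc (-(N : ℤ)) N).biUnion T with hF
  have hFS : (↑F : Set E3) ⊆ S := by
    intro y hy
    simp only [hF, Finset.coe_biUnion, Finset.mem_coe, mem_iUnion, exists_prop] at hy
    obtain ⟨m, -, hm⟩ := hy
    exact hTS m hm
  have hw0 : ∀ y, y ∉ F → w y = 0 := by
    intro y hy
    rw [hw y]
    refine Finset.sum_eq_zero fun m hm => ?_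
    rw [if_neg, mul_zero]
    intro h
    exact hy (Finset.mem_biUnion.2 ⟨m, hm, h⟩)
  have hwnn : ∀ y, 0 ≤ w y := by
    intro y; rw [hw y]
    refine Finset.sum_nonneg fun m _ => mul_nonneg (hc m) ?_
    split_ifs <;> positivity
  -- reduce the integral over `count|S` to a finite sum over `F`
  have hSm : MeasurableSet S := hS.measurableSet
  have h1 : ∫⁻ y, ENNReal.ofReal (w y) * ENNReal.ofReal (g y) ∂((Measure.count : Measure E3).restrict S) =
      ∑ y ∈ F, ENNReal.ofReal (w y * g y) := by
    rw [← union_sdiff_cancel hFS, lintegral_union (hSm.diff F.measurableSet) disjoint_sdiff_right,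
      lintegral_finset]
    have h0 : ∫⁻ y in S \ ↑F, ENNReal.ofReal (w y) * ENNReal.ofReal (g y) ∂(Measure.count : Measure E3) = 0 := by
      rw [setLIntegral_congr_fun (hSm.diff F.measurableSet)
        (g := fun _ => 0) (fun y hy => by rw [hw0 y hy.2, ENNReal.ofReal_zero, zero_mul])]
      simp
    rw [h0, add_zero]
    refine Finset.sum_congr rfl fun y _ => ?_
    rw [Measure.count_singleton, mul_one, ENNReal.ofReal_mul (hwnn y)]
  rw [h1, ← ENNReal.ofReal_sum_of_nonneg (fun y _ => mul_nonneg (hwnn y) (hg y))]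
  congr 1
  -- evaluate the finite sum
  have h2 : ∀ m ∈ Finset.Icc (-(N : ℤ)) N,
      ∑ y ∈ F, (c m * (if y ∈ T m then (1 : ℝ) / (T m).card else 0)) * g y = c m * cval m := by
    intro m hm
    have hsub : T m ⊆ F := Finset.subset_biUnion_of_mem T hm
    rw [← Finset.sum_subset hsub (fun y _ hy => by rw [if_neg hy, mul_zero, zero_mul])]
    rw [Finset.sum_congr rfl (g := fun _ => c m * ((1 : ℝ) / (T m).card) * cval m)
      (fun y hy => by rw [if_pos hy, hgc m y hy])]
    rw [Finset.sum_const, nsmul_eq_mul]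
    have : ((T m).card : ℝ) ≠ 0 := Nat.cast_ne_zero.2 (Finset.card_pos.2 (hTne m)).ne'
    field_simp
  calc ∑ y ∈ F, w y * g y
      = ∑ y ∈ F, ∑ m ∈ Finset.Icc (-(N : ℤ)) N,
          (c m * (if y ∈ T m then (1 : ℝ) / (T m).card else 0)) * g y := by
        refine Finset.sum_congr rfl fun y _ => ?_
        rw [hw y, Finset.sum_mul]
    _ = ∑ m ∈ Finset.Icc (-(N : ℤ)) N,
          ∑ y ∈ F, (c m * (if y ∈ T m then (1 : ℝ) / (T m).card else 0)) * g y := Finset.sum_comm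
    _ = ∑ m ∈ Finset.Icc (-(N : ℤ)) N, c m * cval m := Finset.sum_congr rfl h2

/-! ## The targets of fitted data satisfy the hypotheses -/

/-- The layered set of any data is countable (the range of `pointOf` over `ℤ³`). [folklore] -/
theorem countable_dataSet (e : LData) : (dataSet e).Countable := by
  have h : dataSet e ⊆ Set.range (fun t : ℤ × ℤ × ℤ => pointOf e t.1 t.2.1 t.2.2) := by
    rintro p ⟨m, i, j, rfl⟩
    exact ⟨(m, i, j), rfl⟩
  exact (Set.countable_range _).mono h

/-- `nearCodes L` is nonempty. [folklore] -/
theorem nearCodes_nonempty (L : ℤ) : (nearCodes L).Nonempty := by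
  unfold nearCodes
  split_ifs <;> simp

/-- The targets of every layer form a nonempty set. [folklore] -/
theorem layerTargets_nonempty (e : LData) (m : ℤ) : (layerTargets e m).Nonempty :=
  (nearCodes_nonempty _).image _

/-- The targets lie in the layered set. [folklore] -/
theorem layerTargets_subset_dataSet (e : LData) (m : ℤ) : (↑(layerTargets e m) : Set E3) ⊆ dataSet e :=
  (layerTargets_subset e m).trans (layerOf_subset_dataSet e m)

/-- The targets of distinct layers of normal data are disjoint. [folklore] -/
theorem layerTargets_disjoint {e : LData} (he : IsNormalData e) {m m' : ℤ} (h : m ≠ m') :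
    Disjoint (layerTargets e m) (layerTargets e m') := by
  rw [Finset.disjoint_left]
  intro p hp hp'
  exact h (layer_unique he (layerTargets_subset e m (Finset.mem_coe.2 hp))
    (layerTargets_subset e m' (Finset.mem_coe.2 hp')))

/-- A function prescribed on the pattern points layer by layer is constant on the targets of each
layer. [folklore] -/
theorem const_on_layerTargets {e : LData} {g : E3 → ℝ} {v : ℤ → ℝ}
    (hg : ∀ m i j : ℤ, g (pointOf e m i j) = v m) (m : ℤ) : ∀ y ∈ layerTargets e m, g y = v m := by
  intro y hy
  obtain ⟨i, j, rfl⟩ := layerTargets_subset e m (Finset.mem_coe.2 hy)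
  exact hg m i j

/-- `#{m : |m| ≤ n} = 2n + 1` (real form). [folklore] -/
theorem card_Icc_neg_nat (n : ℕ) : ((Finset.Icc (-(n : ℤ)) n).card : ℝ) = 2 * (n : ℝ) + 1 := by
  rw [Int.card_Icc]
  have h : ((n : ℤ) + 1 - -(n : ℤ)).toNat = 2 * n + 1 := by omega
  rw [h]
  push_cast
  ring

/-! ## The shifted-average weights `c'` -/

/-- **The weights `c'` of the symmetrised shifted layer average** (registered sub-goal
`shiftCoeff_props`): nonnegative, even, supported in `|m| ≤ n + 1`, total mass `1`. [folklore] -/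
theorem shiftCoeff_props : ∀ (n : ℕ), (∀ m : ℤ, 0 ≤ ((1 / (2 * (2 * (n : ℝ) + 1))) * ((if m ∈ Finset.Icc (-(n : ℤ) + 1) ((n : ℤ) + 1) then (1 : ℝ) else 0) + (if m ∈ Finset.Icc (-(n : ℤ) - 1) ((n : ℤ) - 1) then (1 : ℝ) else 0)))) ∧ (∀ m : ℤ, ((1 / (2 * (2 * (n : ℝ) + 1))) * ((if (-m) ∈ Finset.Icc (-(n : ℤ) + 1) ((n : ℤ) + 1) then (1 : ℝ) else 0) + (if (-m) ∈ Finset.Icc (-(n : ℤ) - 1) ((n : ℤ) - 1) then (1 : ℝ) else 0))) = ((1 / (2 * (2 * (n : ℝ) + 1))) * ((if m ∈ Finset.Icc (-(n : ℤ) + 1) ((n : ℤ) + 1) then (1 : ℝ) else 0) + (if m ∈ Finset.Icc (-(n : ℤ) - 1) ((n : ℤ) - 1) then (1 : ℝ) else 0)))) ∧ (∀ m : ℤ, ((n + 1 : ℕ) : ℤ) < |m| → ((1 / (2 * (2 * (n : ℝ) + 1))) * ((if m ∈ Finset.Icc (-(n : ℤ) + 1) ((n : ℤ) + 1) then (1 :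 ℝ) else 0) + (if m ∈ Finset.Icc (-(n : ℤ) - 1) ((n : ℤ) - 1) then (1 : ℝ) else 0))) = 0) ∧ ∑ m ∈ Finset.Icc (-((n + 1 : ℕ) : ℤ)) ((n + 1 : ℕ) : ℤ), ((1 / (2 * (2 * (n : ℝ) + 1))) * ((if m ∈ Finset.Icc (-(n : ℤ) + 1) ((n : ℤ) + 1) then (1 : ℝ) else 0) + (if m ∈ Finset.Icc (-(n : ℤ) - 1) ((n : ℤ) - 1) then (1 : ℝ) else 0))) = 1 := by
  intro n
  refine ⟨fun m => ?_, fun m => ?_, fun m hm => ?_, ?_⟩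
  · have h1 : (0 : ℝ) ≤ (if m ∈ Finset.Icc (-(n : ℤ) + 1) ((n : ℤ) + 1) then (1 : ℝ) else 0) := by
      split_ifs <;> norm_num
    have h2 : (0 : ℝ) ≤ (if m ∈ Finset.Icc (-(n : ℤ) - 1) ((n : ℤ) - 1) then (1 : ℝ) else 0) := by
      split_ifs <;> norm_num
    positivity
  · have e1 : (-m ∈ Finset.Icc (-(n : ℤ) + 1) ((n : ℤ) + 1)) ↔ (m ∈ Finset.Icc (-(n : ℤ) - 1) ((n : ℤ) - 1)) := by
      simp only [Finset.mem_Icc]; omega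
    have e2 : (-m ∈ Finset.Icc (-(n : ℤ) - 1) ((n : ℤ) - 1)) ↔ (m ∈ Finset.Icc (-(n : ℤ) + 1) ((n : ℤ) + 1)) := by
      simp only [Finset.mem_Icc]; omega
    simp only [e1, e2]
    ring
  · have hm' : (n : ℤ) + 1 < |m| := by push_cast at hm; exact hm
    have h1 : m ∉ Finset.Icc (-(n : ℤ) + 1) ((n : ℤ) + 1) := by
      simp only [Finset.mem_Icc, not_and_or, not_le]
      rcases abs_cases m with ⟨h, -⟩ | ⟨h, -⟩ <;> rw [h] at hm' <;> omega
    have h2 : m ∉ Finset.Icc (-(n : ℤ) - 1) ((n : ℤ) - 1) := by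
      simp only [Finset.mem_Icc, not_and_or, not_le]
      rcases abs_cases m with ⟨h, -⟩ | ⟨h, -⟩ <;> rw [h] at hm' <;> omega
    rw [if_neg h1, if_neg h2]
    ring
  · rw [← Finset.mul_sum, Finset.sum_add_distrib, Finset.sum_ite_mem, Finset.sum_ite_mem,
      Finset.sum_const, Finset.sum_const, nsmul_eq_mul, nsmul_eq_mul, mul_one]
    have hsub1 : Finset.Icc (-(n : ℤ) + 1) ((n : ℤ) + 1) ⊆ Finset.Icc (-((n + 1 : ℕ) : ℤ)) ((n + 1 : ℕ) : ℤ) := by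
      intro m; simp only [Finset.mem_Icc]; push_cast; omega
    have hsub2 : Finset.Icc (-(n : ℤ) - 1) ((n : ℤ) - 1) ⊆ Finset.Icc (-((n + 1 : ℕ) : ℤ)) ((n + 1 : ℕ) : ℤ) := by
      intro m; simp only [Finset.mem_Icc]; push_cast; omega
    rw [Finset.inter_eq_right.2 hsub1, Finset.inter_eq_right.2 hsub2, Int.card_Icc, Int.card_Icc]
    have h1 : ((n : ℤ) + 1 + 1 - (-(n : ℤ) + 1)).toNat = 2 * n + 1 := by omega
    have h2 : ((n : ℤ) - 1 + 1 - (-(n : ℤ) - 1)).toNat = 2 * n + 1 := by omega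
    rw [h1, h2]
    have hpos : (0 : ℝ) < 2 * (n : ℝ) + 1 := by positivity
    push_cast
    field_simp
    ring

/-! ## The three identifications, deterministic form -/

/-- Weights of total mass one pass an additive constant through the weighted sum. [folklore] -/
theorem sum_mul_add_const {s : Finset ℤ} (c v : ℤ → ℝ) (K : ℝ) (hc1 : ∑ m ∈ s, c m = 1) :
    ∑ m ∈ s, c m * (v m + K) = (∑ m ∈ s, c m * v m) + K := by
  rw [Finset.sum_congr rfl fun m _ => mul_add (c m) (v m) K, Finset.sum_add_distrib, ← Finset.sum_mul,
    hc1, one_mul]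

/-- **Identification A** (registered sub-goal `lms_ident_A`): against the uniform layer weights over
`|m| ≤ n`, a nonnegative `g` with value `LE e m + K` on layer `m` integrates to `AE n e + K`.
[folklore] -/
theorem lms_ident_A : ∀ (n : ℕ) (S : Set E3) (e : LData), Fits S e → ∀ (g : E3 → ℝ) (K : ℝ), (∀ y, 0 ≤ g y) → (∀ m i j : ℤ, g (pointOf e m i j) = (inLayerInteraction lennardJones e.2.1 + ∑' m' : ℤ, if m' = m then (0 : ℝ) else layerInteraction lennardJones e.2.1 (e.2.2.2 m' - e.2.2.2 m) (haggLabel e.2.2.1 m' - haggLabel e.2.2.1 m) 1) + K) → ∫⁻ y, ENNReal.ofReal ((1 / (2 * (n : ℝ) + 1)) * ∑ m ∈ Finset.Icc (-(n : ℤ)) n, (if y ∈ layerTargets e m then (1 : ℝ) / (layerTargets e m).card else 0)) * ENNReal.ofReal (g y) ∂((Measure.count : Measure E3).restrict S) = ENNReal.ofReal (((1 / (2 * (n : ℝ) + 1)) * ∑ m ∈ Finset.Icc (-(n : ℤ)) n, (inLayerInteraction lennardJones e.2.1 + ∑' m' : ℤ, if m' = m then (0 : ℝ) else layerInteraction lennardJones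 e.2.1 (e.2.2.2 m' - e.2.2.2 m) (haggLabel e.2.2.1 m' - haggLabel e.2.2.1 m) 1)) + K) := by
  intro n S e he g K hg hgc
  obtain ⟨hne, hS⟩ := he
  have hcount : S.Countable := hS ▸ countable_dataSet e
  have hTS : ∀ m, (↑(layerTargets e m) : Set E3) ⊆ S := fun m => hS ▸ layerTargets_subset_dataSet e m
  rw [SlackRigidityPricedFloorsIdent.lms_lintegral_avg_eq S hcount (layerTargets e) hTS
    (layerTargets_nonempty e) (fun m m' h => layerTargets_disjoint hne h) n _ g _ (fun y => rfl) hg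
    (const_on_layerTargets hgc)]
  congr 1
  rw [Finset.sum_add_distrib, Finset.sum_const, nsmul_eq_mul, card_Icc_neg_nat, mul_add]
  have hpos : (0 : ℝ) < 2 * (n : ℝ) + 1 := by positivity
  field_simp

/-- **Identification D** (registered sub-goal `lms_ident_D`): against the uniform layer weights over
`|m| ≤ n`, a nonnegative `g` with value `jump e m + jump e (m−2) + K` on layer `m` integrates to
`DtE n e + K`. [folklore] -/
theorem lms_ident_D : ∀ (n : ℕ) (S : Set E3) (e : LData), Fits S e → ∀ (g : E3 → ℝ) (K : ℝ), (∀ y, 0 ≤ g y) → (∀ m i j : ℤ, g (pointOf e m i j) = (((e.2.2.2 (m + 1) - e.2.2.2 m) - (e.2.2.2 (m + 2) - e.2.2.2 (m + 1))) ^ 2 + ((e.2.2.2 (m - 1) - e.2.2.2 (m - 2)) - (e.2.2.2 m - e.2.2.2 (m - 1))) ^ 2) + K) → ∫⁻ y, ENNReal.ofReal ((1 / (2 * (n : ℝ) + 1)) * ∑ m ∈ Finset.Icc (-(n : ℤ)) n, (if y ∈ layerTargets e m then (1 : ℝ) / (layerTargets e m).card else 0)) * ENNReal.ofReal (g y) ∂((Measure.count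 : Measure E3).restrict S) = ENNReal.ofReal (((1 / (2 * (n : ℝ) + 1)) * ∑ m ∈ Finset.Icc (-(n : ℤ)) n, (((e.2.2.2 (m + 1) - e.2.2.2 m) - (e.2.2.2 (m + 2) - e.2.2.2 (m + 1))) ^ 2 + ((e.2.2.2 (m - 1) - e.2.2.2 (m - 2)) - (e.2.2.2 m - e.2.2.2 (m - 1))) ^ 2)) + K) := by
  intro n S e he g K hg hgc
  obtain ⟨hne, hS⟩ := he
  have hcount : S.Countable := hS ▸ countable_dataSet e
  have hTS : ∀ m, (↑(layerTargets e m) : Set E3) ⊆ S := fun m => hS ▸ layerTargets_subset_dataSet e m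
  rw [SlackRigidityPricedFloorsIdent.lms_lintegral_avg_eq S hcount (layerTargets e) hTS
    (layerTargets_nonempty e) (fun m m' h => layerTargets_disjoint hne h) n _ g _ (fun y => rfl) hg
    (const_on_layerTargets hgc)]
  congr 1
  rw [Finset.sum_add_distrib, Finset.sum_const, nsmul_eq_mul, card_Icc_neg_nat, mul_add]
  have hpos : (0 : ℝ) < 2 * (n : ℝ) + 1 := by positivity
  field_simp

/-- **Identification B** (registered sub-goal `lms_ident_B`): against the symmetrised shifted weights
`c'`, a nonnegative `g` with value `LE e m + K` on layer `m` integrates to `BE n e + K` (`Σ c' = 1`).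
[folklore] -/
theorem lms_ident_B : ∀ (n : ℕ) (S : Set E3) (e : LData), Fits S e → ∀ (g : E3 → ℝ) (K : ℝ), (∀ y, 0 ≤ g y) → (∀ m i j : ℤ, g (pointOf e m i j) = (inLayerInteraction lennardJones e.2.1 + ∑' m' : ℤ, if m' = m then (0 : ℝ) else layerInteraction lennardJones e.2.1 (e.2.2.2 m' - e.2.2.2 m) (haggLabel e.2.2.1 m' - haggLabel e.2.2.1 m) 1) + K) → ∫⁻ y, ENNReal.ofReal (∑ m ∈ Finset.Icc (-((n + 1 : ℕ) : ℤ)) ((n + 1 : ℕ) : ℤ), ((1 / (2 * (2 * (n : ℝ) + 1))) * ((if m ∈ Finset.Icc (-(n : ℤ) + 1) ((n : ℤ) + 1) then (1 : ℝ) else 0) + (if m ∈ Finset.Icc (-(n : ℤ) - 1) ((n : ℤ) - 1) then (1 : ℝ) else 0))) * (if y ∈ layerTargets e m then (1 : ℝ) / (layerTargets e m).card else 0)) * ENNReal.ofReal (g y) ∂((Measure.count : Measure E3).restrict S) = ENNReal.ofReal ((∑ m ∈ Finset.Icc (-((n + 1 : ℕ) : ℤ)) ((n + 1 : ℕ) :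 ℤ), ((1 / (2 * (2 * (n : ℝ) + 1))) * ((if m ∈ Finset.Icc (-(n : ℤ) + 1) ((n : ℤ) + 1) then (1 : ℝ) else 0) + (if m ∈ Finset.Icc (-(n : ℤ) - 1) ((n : ℤ) - 1) then (1 : ℝ) else 0))) * (inLayerInteraction lennardJones e.2.1 + ∑' m' : ℤ, if m' = m then (0 : ℝ) else layerInteraction lennardJones e.2.1 (e.2.2.2 m' - e.2.2.2 m) (haggLabel e.2.2.1 m' - haggLabel e.2.2.1 m) 1)) + K) := by
  intro n S e he g K hg hgc
  obtain ⟨hne, hS⟩ := he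
  have hcount : S.Countable := hS ▸ countable_dataSet e
  have hTS : ∀ m, (↑(layerTargets e m) : Set E3) ⊆ S := fun m => hS ▸ layerTargets_subset_dataSet e m
  obtain ⟨hc0, -, -, hc1⟩ := shiftCoeff_props n
  rw [lms_lintegral_weighted_eq S hcount (layerTargets e) hTS (layerTargets_nonempty e)
    (fun m m' h => layerTargets_disjoint hne h) (n + 1) _ hc0 _ g _ (fun y => rfl) hg
    (const_on_layerTargets hgc)]
  congr 1
  exact sum_mul_add_const _ _ K hc1

/-! ## The jump functional of re-rooted data -/

/-- **`DE` of the re-rooted data** (registered sub-goal `DE_rerootData`): the symmetric increment-jump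
functional at the root of the data re-rooted at layer `m` is `jump e m + jump e (m − 2)`. [folklore] -/
theorem DE_rerootData : ∀ (e : LData) (m : ℤ), (((rerootData e m).2.2.2 1 - (rerootData e m).2.2.2 0) - ((rerootData e m).2.2.2 2 - (rerootData e m).2.2.2 1)) ^ 2 + (((rerootData e m).2.2.2 (-1) - (rerootData e m).2.2.2 (-2)) - ((rerootData e m).2.2.2 0 - (rerootData e m).2.2.2 (-1))) ^ 2 = ((e.2.2.2 (m + 1) - e.2.2.2 m) - (e.2.2.2 (m + 2) - e.2.2.2 (m + 1))) ^ 2 + ((e.2.2.2 (m - 1) - e.2.2.2 (m - 2)) - (e.2.2.2 m - e.2.2.2 (m - 1))) ^ 2 := by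
  intro e m
  obtain ⟨T, a, s, z⟩ := e
  simp only [rerootData]
  rw [show (1 : ℤ) + m = m + 1 by ring, show (0 : ℤ) + m = m by ring, show (2 : ℤ) + m = m + 2 by ring,
    show (-1 : ℤ) + m = m - 1 by ring, show (-2 : ℤ) + m = m - 2 by ring]
  ring

end Summit.AtomisticToContinuum.Crystallization.Theorems.SlackRigidityPricedFloorsIncrIdent

end
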